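import Mathlib
import Summits.CriticalPhenomena.SAWScalingLimit.Theorems.SAWRenewalTightnessConfinementPositivityRademacherTube
import HarnessLib

/-!
# Crux `ConfinementPositivity` (stmt-CriticalPhenomena-17587), line `Sketch` (sign-universality):
# the cosine tube comparison for concatenations of flip-symmetric pieces

Generic engine of stub B′u (`stub_unpinnedSlabTube`) of the lead skeleton `Cruxes/ConfinementPositivity/Lines/Sketch.lean`.
Abstract setting: a type `P` of *pieces* with a weight `ν : P → ℝ≥0∞`, an integer *height increment*
`H : P → ℤ`, a *vertical extent* `e : P → ℕ` with `|H p| ≤ e p`, an integer *span* `sp : P → ℤ`, and a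
*flip* `φ : P ≃ P` preserving `ν, e, sp` and negating `H` (for Kesten's irreducible bridges: the word flip
`y ↦ -y`, `Theorems/SAWRenewalTightnessTubeLowerBoundFlipWord.lean`).  A `k`-tuple `f : Fin k → P` is a
concatenation; its piece-boundary heights are the partial sums `y + Σ_{i<j} H (f i)`.

* `T k y ℓ` (written out): the `ν`-mass of the `k`-tuples of total span `ℓ` whose piece-boundary heights from
  the start `y` stay in `[-r, r]` and whose pieces have extent `≤ E₀`;
* `G k ℓ` (written out): the `ν`-mass of the `k`-tuples of total span `ℓ` weighted by `∏ θ (f i)`,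
  `θ p = [e p ≤ E₀] · exp (-(π/(2r))² (e p)²)`.

Main result `cosineTube_claim`: for `|y| ≤ r` and `2 E₀ ≤ r`,
`ofReal (cos (π y/(2r))) · G k ℓ ≤ T k y ℓ` — the word-level form of the cosine sub-solution of
`Theorems.stub_rademacherTube` (the one-step recursion is averaged over the flip of the FIRST piece only, so no
decomposition of the later pieces is ever needed).  At `y = 0` this says: the tube mass is at least the
`θ`-weighted mass.  Pure combinatorics/real analysis; nothing about SAWs.
-/

noncomputable section

open scoped BigOperators ENNReal
open Classical

namespace Summit.CriticalPhenomena.SAWScalingLimit.Theorems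

namespace BridgeTubeCosine

variable {P : Type*}

/-! ### Splitting `k+1`-tuples into the first piece and the rest -/

/-- Partial sums of `H` along `Fin.cons s g`: for `j ≥ 1` they are `H s` plus the partial sums along `g`. -/
theorem psum_cons (H : P → ℤ) {k : ℕ} (s : P) (g : Fin k → P) (j : ℕ) :
    (∑ i : Fin (k + 1), if (i : ℕ) < j + 1 then H ((Fin.cons s g : Fin (k + 1) → P) i) else 0) =
      H s + ∑ i : Fin k, if (i : ℕ) < j then H (g i) else 0 := by
  rw [Fin.sum_univ_succ]
  simp only [Fin.val_zero, Nat.zero_lt_succ, if_true, Fin.cons_zero, Fin.val_succ,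
    Nat.add_lt_add_iff_right, Fin.cons_succ]

/-- The `j = 0` partial sum vanishes. -/
theorem psum_zero (H : P → ℤ) {k : ℕ} (f : Fin k → P) :
    (∑ i : Fin k, if (i : ℕ) < 0 then H (f i) else 0) = 0 := by
  simp

/-- `(∀ j ≤ m+1, Q j) ↔ Q 0 ∧ ∀ j ≤ m, Q (j+1)`.

Deprecated duplicate (dedup-03058): restates `rademacherTube_forall_le_succ_iff`
(`Theorems/SAWRenewalTightnessConfinementPositivityRademacherTube.lean`, imported here, same namespace
`Summit.CriticalPhenomena.SAWScalingLimit.Theorems`); use that lemma. -/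
@[deprecated rademacherTube_forall_le_succ_iff (since := "2026-08-17")]
theorem forall_le_succ_iff (m : ℕ) (Q : ℕ → Prop) :
    (∀ j ≤ m + 1, Q j) ↔ Q 0 ∧ ∀ j ≤ m, Q (j + 1) :=
  rademacherTube_forall_le_succ_iff m Q

/-- The tube predicate along `Fin.cons s g` from `y` is: `|y| ≤ r` and the tube predicate along `g` from `y + H s`. -/
theorem tubePred_cons_iff (H : P → ℤ) (r : ℤ) {k : ℕ} (s : P) (g : Fin k → P) (y : ℤ) :
    (∀ j ≤ k + 1, |y + ∑ i : Fin (k + 1), (if (i : ℕ) < j then H ((Fin.cons s g : Fin (k + 1) → P) i) else 0)| ≤ r) ↔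
      |y| ≤ r ∧ ∀ j ≤ k, |(y + H s) + ∑ i : Fin k, (if (i : ℕ) < j then H (g i) else 0)| ≤ r := by
  rw [rademacherTube_forall_le_succ_iff]
  refine and_congr ?_ (forall_congr' fun j => forall_congr' fun _ => ?_)
  · rw [psum_zero, add_zero]
  · rw [psum_cons, add_assoc]

/-- Products along `Fin.cons`. -/
theorem prod_cons (w : P → ℝ≥0∞) {k : ℕ} (s : P) (g : Fin k → P) :
    (∏ i : Fin (k + 1), w ((Fin.cons s g : Fin (k + 1) → P) i)) = w s * ∏ i : Fin k, w (g i) := by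
  rw [Fin.prod_univ_succ]
  simp only [Fin.cons_zero, Fin.cons_succ]

/-- Sums (of spans) along `Fin.cons`. -/
theorem sum_cons (sp : P → ℤ) {k : ℕ} (s : P) (g : Fin k → P) :
    (∑ i : Fin (k + 1), sp ((Fin.cons s g : Fin (k + 1) → P) i)) = sp s + ∑ i : Fin k, sp (g i) := by
  rw [Fin.sum_univ_succ]
  simp only [Fin.cons_zero, Fin.cons_succ]

/-- `∀ i, Q ((Fin.cons s g) i) ↔ Q s ∧ ∀ i, Q (g i)`. -/
theorem forall_cons_iff (Q : P → Prop) {k : ℕ} (s : P) (g : Fin k → P) :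
    (∀ i : Fin (k + 1), Q ((Fin.cons s g : Fin (k + 1) → P) i)) ↔ Q s ∧ ∀ i, Q (g i) := by
  rw [Fin.forall_fin_succ]
  simp only [Fin.cons_zero, Fin.cons_succ]

/-- A `tsum` over `Fin (k+1) → P` is an iterated `tsum` over the first piece and the remaining `k`-tuple. -/
theorem tsum_succ_eq (k : ℕ) (F : (Fin (k + 1) → P) → ℝ≥0∞) :
    ∑' f : Fin (k + 1) → P, F f = ∑' s : P, ∑' g : Fin k → P, F (Fin.cons s g) := by
  rw [← (Fin.consEquiv (fun _ : Fin (k + 1) => P)).tsum_eq F, ENNReal.tsum_prod']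
  rfl

/-! ### The two masses at level `0` -/

/-- At `k = 0` the only tuple is the empty one. -/
theorem tsum_fin_zero (F : (Fin 0 → P) → ℝ≥0∞) : ∑' f : Fin 0 → P, F f = F Fin.elim0 := by
  rw [tsum_eq_single (Fin.elim0 : Fin 0 → P)]
  intro f hf
  exact absurd (Subsingleton.elim f _) hf

/-! ### Real-analysis inputs (from the `stub_rademacherTube` file) -/

/-- For `|y| ≤ r` (`r ≥ 1`) the start factor `cos (π y/(2r))` is nonnegative. -/
theorem cos_start_nonneg (r : ℕ) (y : ℤ) (hr : 1 ≤ r) (hy : |y| ≤ (r : ℤ)) :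
    0 ≤ Real.cos (Real.pi / (2 * r) * y) := by
  have hr' : (0 : ℝ) < r := by exact_mod_cast hr
  have hy' : |(y : ℝ)| ≤ r := by rw [← Int.cast_abs]; exact_mod_cast hy
  rw [← Real.cos_abs, abs_mul, abs_of_pos (by positivity : 0 < Real.pi / (2 * r))]
  apply Real.cos_nonneg_of_neg_pi_div_two_le_of_le
  · have : 0 ≤ Real.pi / (2 * r) * |(y : ℝ)| := by positivity
    linarith [Real.pi_pos]
  · rw [div_mul_eq_mul_div, div_le_div_iff₀ (by positivity) (by norm_num)]
    nlinarith [Real.pi_pos, abs_nonneg (y : ℝ)]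

/-- The piece factor: for `|H| ≤ e ≤ E₀`, `2 E₀ ≤ r`, `exp (-(π/(2r))² e²) ≤ cos (π H/(2r))`. -/
theorem exp_le_cos_piece (r E₀ : ℕ) (hr : 1 ≤ r) (hE : 2 * E₀ ≤ r) (H : ℤ) (e : ℕ) (hHe : |H| ≤ (e : ℤ))
    (he : e ≤ E₀) :
    Real.exp (-((Real.pi / (2 * r)) ^ 2 * (e : ℝ) ^ 2)) ≤ Real.cos (Real.pi / (2 * r) * H) := by
  have hr' : (0 : ℝ) < r := by exact_mod_cast hr
  have h2e : 2 * e ≤ r := le_trans (Nat.mul_le_mul_left 2 he) hE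
  obtain ⟨h0, h1⟩ := rademacherTube_step_angle r e hr h2e
  have hHe' : |(H : ℝ)| ≤ e := by rw [← Int.cast_abs]; exact_mod_cast hHe
  -- `cos (a H) = cos (a |H|) ≥ cos (a e)` (cos is antitone on `[0, π]`) `≥ exp (-(a e)²)`
  have ha : 0 < Real.pi / (2 * r) := by positivity
  have hcos_mono : Real.cos (Real.pi / (2 * r) * e) ≤ Real.cos (Real.pi / (2 * r) * H) := by
    rw [← Real.cos_abs (Real.pi / (2 * r) * H), abs_mul, abs_of_pos ha]
    apply Real.cos_le_cos_of_nonneg_of_le_pi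
    · positivity
    · linarith [Real.pi_le_four, Real.pi_pos]
    · exact mul_le_mul_of_nonneg_left hHe' ha.le
  have hexp := rademacherTube_exp_neg_sq_le_cos h0 (by linarith [Real.pi_le_four])
  rw [show -((Real.pi / (2 * r)) ^ 2 * (e : ℝ) ^ 2) = -(Real.pi / (2 * r) * e) ^ 2 by ring]
  exact hexp.trans hcos_mono

/-- The flip average: `cos (a (y + H)) + cos (a (y - H)) = 2 cos (a y) cos (a H)`. -/
theorem cos_add_cos_flip (a y H : ℝ) :
    Real.cos (a * (y + H)) + Real.cos (a * (y - H)) = 2 * Real.cos (a * y) * Real.cos (a * H) := by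
  rw [mul_add, mul_sub, Real.cos_add, Real.cos_sub]
  ring

/-- If `|y| ≤ r`, `|H| ≤ r/2` and `r < |y + H|` then `|y - H| ≤ r` and `cos (π (y+H)/(2r)) ≤ 0`. -/
theorem flip_out_case (r : ℕ) (y H : ℤ) (hr : 1 ≤ r) (hy : |y| ≤ (r : ℤ)) (hH : 2 * |H| ≤ (r : ℤ))
    (hout : (r : ℤ) < |y + H|) : |y - H| ≤ (r : ℤ) ∧ Real.cos (Real.pi / (2 * r) * ((y + H : ℤ) : ℝ)) ≤ 0 := by
  have h2H : |2 * H| ≤ (r : ℤ) := by rwa [abs_mul, abs_two]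
  obtain ⟨hy1, hy2⟩ := abs_le.1 hy
  obtain ⟨hH1, hH2⟩ := abs_le.1 h2H
  constructor
  · rcases lt_abs.1 hout with h | h <;> (refine abs_le.2 ⟨?_, ?_⟩ <;> omega)
  · apply rademacherTube_cos_start_nonpos r (y + H) hr hout
    linarith [abs_add_le y H]

end BridgeTubeCosine

open BridgeTubeCosine in
/-- **Cosine tube comparison for concatenations of flip-symmetric pieces.**  With pieces `P` weighted by
`ν`, height increments `H`, extents `e ≥ |H|`, spans `sp`, and a flip `φ` preserving `ν, e, sp` and negating
`H`: for `r ≥ 1`, `2 E₀ ≤ r` and every `k`, start `|y| ≤ r` and total span `ℓ`,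
`ofReal (cos (π y/(2r))) · Σ'_{f : Fin k → P, Σ sp = ℓ} ∏ ν(fᵢ) θ(fᵢ) ≤ Σ'_{f, Σ sp = ℓ, tube from y, extents ≤ E₀} ∏ ν(fᵢ)`
where `θ p = [e p ≤ E₀] exp (-(π/(2r))² (e p)²)`. -/
theorem cosineTube_claim : ∀ {P : Type} (ν : P → ℝ≥0∞) (H : P → ℤ) (e : P → ℕ) (sp : P → ℤ) (φ : P ≃ P),
    (∀ p, ν (φ p) = ν p) → (∀ p, H (φ p) = -H p) → (∀ p, e (φ p) = e p) →
    (∀ p, sp (φ p) = sp p) → (∀ p, |H p| ≤ (e p : ℤ)) → ∀ (r E₀ : ℕ), 1 ≤ r → 2 * E₀ ≤ r →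
    ∀ (k : ℕ) (y ℓ : ℤ), |y| ≤ (r : ℤ) →
      ENNReal.ofReal (Real.cos (Real.pi / (2 * r) * y)) *
          (∑' f : Fin k → P, if (∑ i, sp (f i)) = ℓ then
              ∏ i, (ν (f i) * (if e (f i) ≤ E₀ then
                ENNReal.ofReal (Real.exp (-((Real.pi / (2 * r)) ^ 2 * (e (f i) : ℝ) ^ 2))) else 0)) else 0) ≤
        ∑' f : Fin k → P, if ((∑ i, sp (f i)) = ℓ ∧
            (∀ j ≤ k, |y + ∑ i : Fin k, (if (i : ℕ) < j then H (f i) else 0)| ≤ (r : ℤ)) ∧ ∀ i, e (f i) ≤ E₀) then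
              ∏ i, ν (f i) else 0 := by
  intro P ν H e sp φ hν hH he hsp hHe r E₀ hr hE
  -- abbreviations
  set a : ℝ := Real.pi / (2 * r) with ha_def
  set θ : P → ℝ≥0∞ := fun p => if e p ≤ E₀ then ENNReal.ofReal (Real.exp (-(a ^ 2 * (e p : ℝ) ^ 2))) else 0
    with hθ_def
  intro k
  induction k with
  | zero =>
    intro y ℓ hy
    rw [tsum_fin_zero, tsum_fin_zero]
    simp only [Finset.univ_eq_empty, Finset.sum_empty, Finset.prod_empty, add_zero,
      IsEmpty.forall_iff, and_true]
    by_cases hℓ : (0 : ℤ) = ℓ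
    · rw [if_pos hℓ, mul_one, if_pos ⟨hℓ, fun j _ => hy⟩]
      exact ENNReal.ofReal_le_one.2 (Real.cos_le_one _)
    · rw [if_neg hℓ, mul_zero]
      exact zero_le
  | succ k ih =>
    intro y ℓ hy
    -- rewrite both sides as iterated sums over the first piece `s` and the rest `g`
    rw [tsum_succ_eq, tsum_succ_eq]
    -- the level-`k` masses as functions of the start and the remaining span
    set T : ℤ → ℤ → ℝ≥0∞ := fun y' ℓ' => ∑' g : Fin k → P, if ((∑ i, sp (g i)) = ℓ' ∧
        (∀ j ≤ k, |y' + ∑ i : Fin k, (if (i : ℕ) < j then H (g i) else 0)| ≤ (r : ℤ)) ∧ ∀ i, e (g i) ≤ E₀) then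
          ∏ i, ν (g i) else 0 with hT_def
    set G : ℤ → ℝ≥0∞ := fun ℓ' => ∑' g : Fin k → P, if (∑ i, sp (g i)) = ℓ' then
        ∏ i, (ν (g i) * θ (g i)) else 0 with hG_def
    -- inner sums, right side
    have hR : ∀ s : P, (∑' g : Fin k → P, if ((∑ i, sp ((Fin.cons s g : Fin (k + 1) → P) i)) = ℓ ∧
        (∀ j ≤ k + 1, |y + ∑ i : Fin (k + 1), (if (i : ℕ) < j then H ((Fin.cons s g : Fin (k + 1) → P) i) else 0)| ≤ (r : ℤ)) ∧
          ∀ i, e ((Fin.cons s g : Fin (k + 1) → P) i) ≤ E₀) then ∏ i, ν ((Fin.cons s g : Fin (k + 1) → P) i) else 0) =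
        (if e s ≤ E₀ then ν s else 0) * T (y + H s) (ℓ - sp s) := by
      intro s
      rw [hT_def]
      dsimp only
      rw [← ENNReal.tsum_mul_left]
      refine tsum_congr fun g => ?_
      simp only [tubePred_cons_iff H (r : ℤ) s g y, sum_cons sp s g, forall_cons_iff (fun p => e p ≤ E₀) s g,
        prod_cons ν s g]
      by_cases hes : e s ≤ E₀
      · simp only [hes, true_and, if_true]
        by_cases hc : (∑ i, sp (g i)) = ℓ - sp s ∧
            (∀ j ≤ k, |y + H s + ∑ i : Fin k, (if (i : ℕ) < j then H (g i) else 0)| ≤ (r : ℤ)) ∧ ∀ i, e (g i) ≤ E₀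
        · rw [if_pos hc, if_pos]
          exact ⟨by rw [hc.1]; ring, ⟨hy, hc.2.1⟩, hc.2.2⟩
        · rw [if_neg hc, if_neg, mul_zero]
          rintro ⟨h1, ⟨-, h2⟩, h3⟩
          exact hc ⟨by rw [← h1]; ring, h2, h3⟩
      · simp only [hes, false_and, and_false, if_false, zero_mul]
    -- inner sums, left side
    have hL : ∀ s : P, (∑' g : Fin k → P, if (∑ i, sp ((Fin.cons s g : Fin (k + 1) → P) i)) = ℓ then
        ∏ i, (ν ((Fin.cons s g : Fin (k + 1) → P) i) * θ ((Fin.cons s g : Fin (k + 1) → P) i)) else 0) =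
        (ν s * θ s) * G (ℓ - sp s) := by
      intro s
      rw [hG_def]
      dsimp only
      rw [← ENNReal.tsum_mul_left]
      refine tsum_congr fun g => ?_
      rw [sum_cons, prod_cons (fun p => ν p * θ p)]
      by_cases hc : (∑ i, sp (g i)) = ℓ - sp s
      · rw [if_pos hc, if_pos (by rw [hc]; ring)]
      · rw [if_neg hc, if_neg, mul_zero]
        intro h1
        exact hc (by rw [← h1]; ring)
    -- the key pointwise bound after flip-averaging
    have key : ∀ s : P, e s ≤ E₀ →
        ENNReal.ofReal (2 * Real.cos (a * y) * Real.cos (a * H s)) * G (ℓ - sp s) ≤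
          T (y + H s) (ℓ - sp s) + T (y - H s) (ℓ - sp s) := by
      intro s hes
      have hHs : 2 * |H s| ≤ (r : ℤ) := by
        have := hHe s
        have hes' : (e s : ℤ) ≤ E₀ := by exact_mod_cast hes
        have hE' : 2 * (E₀ : ℤ) ≤ r := by exact_mod_cast hE
        omega
      have ihp : |y + H s| ≤ (r : ℤ) → ENNReal.ofReal (Real.cos (a * ((y + H s : ℤ) : ℝ))) * G (ℓ - sp s) ≤
          T (y + H s) (ℓ - sp s) := fun h => ih (y + H s) (ℓ - sp s) h
      have ihm : |y - H s| ≤ (r : ℤ) → ENNReal.ofReal (Real.cos (a * ((y - H s : ℤ) : ℝ))) * G (ℓ - sp s) ≤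
          T (y - H s) (ℓ - sp s) := fun h => ih (y - H s) (ℓ - sp s) h
      have hsum : Real.cos (a * ((y + H s : ℤ) : ℝ)) + Real.cos (a * ((y - H s : ℤ) : ℝ)) =
          2 * Real.cos (a * y) * Real.cos (a * H s) := by
        push_cast
        exact cos_add_cos_flip a y (H s)
      by_cases hp : |y + H s| ≤ (r : ℤ)
      · by_cases hm : |y - H s| ≤ (r : ℤ)
        · calc ENNReal.ofReal (2 * Real.cos (a * y) * Real.cos (a * H s)) * G (ℓ - sp s)
              = ENNReal.ofReal (Real.cos (a * ((y + H s : ℤ) : ℝ)) + Real.cos (a * ((y - H s : ℤ) : ℝ))) *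
                  G (ℓ - sp s) := by rw [hsum]
            _ ≤ (ENNReal.ofReal (Real.cos (a * ((y + H s : ℤ) : ℝ))) +
                  ENNReal.ofReal (Real.cos (a * ((y - H s : ℤ) : ℝ)))) * G (ℓ - sp s) :=
                mul_le_mul_left ENNReal.ofReal_add_le _
            _ = _ := by rw [add_mul]
            _ ≤ _ := add_le_add (ihp hp) (ihm hm)
        · -- `y - H s` is out: its cosine is nonpositive, use the `+` branch alone
          have hout : (r : ℤ) < |y - H s| := not_le.1 hm
          have hflip := flip_out_case r y (-H s) hr hy (by rwa [abs_neg]) (by rwa [← sub_eq_add_neg])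
          have hcos : Real.cos (a * ((y - H s : ℤ) : ℝ)) ≤ 0 := by
            have := hflip.2
            rwa [← sub_eq_add_neg] at this
          calc ENNReal.ofReal (2 * Real.cos (a * y) * Real.cos (a * H s)) * G (ℓ - sp s)
              ≤ ENNReal.ofReal (Real.cos (a * ((y + H s : ℤ) : ℝ))) * G (ℓ - sp s) := by
                refine mul_le_mul_left (ENNReal.ofReal_le_ofReal ?_) _
                linarith
            _ ≤ T (y + H s) (ℓ - sp s) := ihp hp
            _ ≤ _ := le_self_add
      · -- `y + H s` is out
        have hout : (r : ℤ) < |y + H s| := not_le.1 hp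
        obtain ⟨hm, hcos⟩ := flip_out_case r y (H s) hr hy hHs hout
        calc ENNReal.ofReal (2 * Real.cos (a * y) * Real.cos (a * H s)) * G (ℓ - sp s)
            ≤ ENNReal.ofReal (Real.cos (a * ((y - H s : ℤ) : ℝ))) * G (ℓ - sp s) := by
              refine mul_le_mul_left (ENNReal.ofReal_le_ofReal ?_) _
              linarith
          _ ≤ T (y - H s) (ℓ - sp s) := ihm hm
          _ ≤ _ := le_add_self
    -- flip-averaging of the right side: `Σ_s F s = Σ_s F (φ s)`
    have hflipsum : (∑' s : P, (if e s ≤ E₀ then ν s else 0) * T (y + H s) (ℓ - sp s)) =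
        ∑' s : P, (if e s ≤ E₀ then ν s else 0) * T (y - H s) (ℓ - sp s) := by
      rw [← φ.tsum_eq]
      refine tsum_congr fun s => ?_
      rw [he, hν, hH, hsp, ← sub_eq_add_neg]
    -- the piece factor `θ s ≤ cos (a H s)` and the start factor `cos (a y) ≥ 0`
    have hθ_le : ∀ s : P, e s ≤ E₀ → θ s ≤ ENNReal.ofReal (Real.cos (a * H s)) := by
      intro s hes
      simp only [hθ_def, hes, if_true]
      exact ENNReal.ofReal_le_ofReal (exp_le_cos_piece r E₀ hr hE (H s) (e s) (hHe s) hes)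
    have hcosy : 0 ≤ Real.cos (a * y) := cos_start_nonneg r y hr hy
    -- pointwise in `s`: `2 · cos(ay) ν θ G ≤ [e ≤ E₀] ν (T(y+H) + T(y-H))`
    have hpt : ∀ s : P, 2 * (ENNReal.ofReal (Real.cos (a * y)) * (ν s * θ s * G (ℓ - sp s))) ≤
        (if e s ≤ E₀ then ν s else 0) * (T (y + H s) (ℓ - sp s) + T (y - H s) (ℓ - sp s)) := by
      intro s
      by_cases hes : e s ≤ E₀
      · rw [if_pos hes]
        calc 2 * (ENNReal.ofReal (Real.cos (a * y)) * (ν s * θ s * G (ℓ - sp s)))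
            = ν s * ((2 * ENNReal.ofReal (Real.cos (a * y)) * θ s) * G (ℓ - sp s)) := by ring
          _ ≤ ν s * (ENNReal.ofReal (2 * Real.cos (a * y) * Real.cos (a * H s)) * G (ℓ - sp s)) := by
              gcongr
              rw [ENNReal.ofReal_mul (by positivity), ENNReal.ofReal_mul (by norm_num),
                ENNReal.ofReal_ofNat]
              gcongr
              exact hθ_le s hes
          _ ≤ ν s * (T (y + H s) (ℓ - sp s) + T (y - H s) (ℓ - sp s)) := by
              gcongr
              exact key s hes
      · have hθ0 : θ s = 0 := by simp only [hθ_def, hes, if_false]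
        rw [hθ0, if_neg hes]
        simp
    -- sum the pointwise bound and use the flip symmetry of the right side
    have hsum2 : 2 * (ENNReal.ofReal (Real.cos (a * y)) * ∑' s : P, ν s * θ s * G (ℓ - sp s)) ≤
        ∑' s : P, (if e s ≤ E₀ then ν s else 0) * (T (y + H s) (ℓ - sp s) + T (y - H s) (ℓ - sp s)) := by
      rw [← ENNReal.tsum_mul_left, ← ENNReal.tsum_mul_left]
      exact ENNReal.tsum_le_tsum hpt
    have hsplit : (∑' s : P, (if e s ≤ E₀ then ν s else 0) *
        (T (y + H s) (ℓ - sp s) + T (y - H s) (ℓ - sp s))) =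
        2 * ∑' s : P, (if e s ≤ E₀ then ν s else 0) * T (y + H s) (ℓ - sp s) := by
      simp_rw [mul_add]
      rw [ENNReal.tsum_add, ← hflipsum, two_mul]
    rw [hsplit] at hsum2
    have main := (ENNReal.mul_le_mul_iff_right two_ne_zero ENNReal.ofNat_ne_top).1 hsum2
    exact le_trans (le_of_eq (congrArg _ (tsum_congr hL)))
      (le_trans main (le_of_eq (tsum_congr hR).symm))

end Summit.CriticalPhenomena.SAWScalingLimit.Theorems
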